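/-
Copyright (c) 2026 the pub-hodgecm-mathlib formalisation cell (harness21).  Prover seat hodgecm-mathlib-LH5-p04 (g9); G-rows dealer ∕ reader F0P3a-p09 (g13) (LEAD F0P3a-plan (g15)
T14-67 rule 20 ∕ T14-69 (1)); CENSUS «EP-G» v1 (F0P3a-p09 (g12)) §5 row (G6)-SC «SC-NO-PARAHORIC ∕ SC-NO-IWAHORI», THIN DRESS (T-D′) of the generic bricks ★ (T-H)
`Combinatorics/SimpleGraph/TreeFiniteSupportHarmonic` and ★ (T-A) `RepresentationTheory/TreeActionSupercuspidalNoFixedVector` (F0P3b-p01 (g23)); 2026-09-02.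
-/
import Literature.NumberTheory.Automorphic.UnitaryLatticeTreeLevelIndices                    -- ★ p852870 (LH10-p02): `isOpen_∕isCompact_glInt_subgroupOf`, `…_conj_glInt_subgroupOf`, `…_glInt_inf_conj_glInt_subgroupOf`, `setOf_orbit_conj_eq_image_neighborSet_root`, `setOf_orbit_root_eq_image_neighborSet_N₁`
import Literature.NumberTheory.Automorphic.UnitaryLatticeTreeTypeTwoTransitive                -- ★ `isTree_latticeGraph_three_of_unramified`; brings ★ `UnitaryLatticeTreeStar` (`exists_latticeGraphIso_root_eq`, `exists_latticeGraphIso_N₁_eq`, `mem_neighborSet_root_iff`)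
import Literature.NumberTheory.Automorphic.UnitaryLatticeTreeValency                          -- ★ `exists_typeFun`, `ncard_neighborSet_eq_typeFun`, `finite_neighborSet`, `isVertexLattice_two_of_not_isSelfDualLattice`
import Literature.Combinatorics.SimpleGraph.TreeFiniteSupportHarmonic                         -- ★ p852884 (T-H): `TreeHarmonic.eq_zero_of_forall_finsum_adj_eq_zero`, `TreeHarmonic.exists_adj_adj_of_dist_eq_two`
import Literature.RepresentationTheory.TreeActionSupercuspidalNoFixedVector                   -- ★ (T-A) (F0P3b-p01 (g23)): `TreeAction.fixedPoints_eq_bot_of_isSupercuspidal_of_permHom`; brings ★ `AdmissibleInvariantFormSchur` (`IsSupercuspidal.hasCompactSupport_matrixCoeff`)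
import Literature.NumberTheory.Automorphic.SmoothRepresentationIrreducibleContragredientProofs  -- ★ `IsSmooth.exists_fixedPoints_projection`, `Representation.apply_eq_apply_of_quotient_eq`
import HarnessLib

/-!
# A SUPERCUSPIDAL representation of the unramified `U(3)` has no vector fixed by a vertex stabiliser `K₀`, `K₁` or by the Iwahori subgroup `I = K₀ ⊓ K₁`
# («SC-NO-PARAHORIC ∕ SC-NO-IWAHORI»; Borel 1976 §4, Casselman 1995 §3.3 — by the elementary tree-harmonic route on the Bruhat–Tits tree of `U(3)`)

Topic `NumberTheory/Automorphic`; namespaces `Representation` (§0, two generic helpers) and `Literature.NumberTheory.Automorphic.UnitaryLatticeTree` (§1–§3).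
THEOREMS ONLY (no definition ∕ instance ∕ notation ∕ named fact ∕ `sorry`).  Cell `pub/hodgecm-mathlib`, crux H413 = `stmt-HodgeConjecture-24833` (`--supports` lane,
helper); LEAD F0P3a-plan (g15) T14-67 rule-20 brick; CENSUS «EP-G» v1 (F0P3a-p09 (g12)) §5 row **(G6)-SC**, dealt BY NAME to this seat as the THIN DRESS (T-D′) of
F0P3b-p01 (g23)'s generic bricks ★ (T-H) `TreeFiniteSupportHarmonic` (p852884) and ★ (T-A) `TreeActionSupercuspidalNoFixedVector` (G-row dealer F0P3a-p09 (g13)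
«= SPLIT» 22:41:43Z).  Seat LH5-p04 (g9).  The level spellings `K₀ = (glInt 3 K).subgroupOf U`, `K₁ = ((glInt 3 K).map (MulAut.conj g₁).toMonoidHom).subgroupOf U`
(`g₁ = diag(1,1,ϖ)`), `I = K₀ ⊓ K₁` are VERBATIM those of ★ EULER-G FILE 1 `UnitaryLatticeTreeFixedCosetFlags` (LH6-p03) and ★ `UnitaryLatticeTreeLevelIndices` (LH10-p02).

THE SETTING.  `K` a field with `Valued K ℤᵐ⁰` (and the compatible `ValuativeRel`, for ★ `glInt`) whose valuation ring `𝒪` is COMPACT, an unramified datum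
`hd : UnramifiedLocalConjDatum σ ϖ` with `σ` continuous and a residual reduction `σk` of `σ` (`|𝓀| = q²`, `σk = Frob_q` — the binder family of ★
`index_inf_subgroupOf_eq_of_unramified`, used here only for the valencies `q³ + 1`, `q + 1 ≥ 2` and the finiteness of the stars), `J₀ = antidiag(1,1,1)`,
`U := unitaryGroupOfForm σ J₀ ≤ GL₃(K)` (the model of `U(3)(L⁺_v)` at a non-split unramified `v`, ★ `localNonsplitEquiv`), with COMPACT CENTRE (`hZ`, a binder: true for the
honest unitary group, whose centre is the norm-one scalars).  `ρ` is an ADMISSIBLE SUPERCUSPIDAL representation of `U` on a complex vector space (★ `Representation.IsAdmissible`,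
★ `Representation.IsSupercuspidal` = Harish-Chandra's «all smooth matrix coefficients supported in `C · Z(U)`»; an irreducible smooth supercuspidal is admissible by ★
`IsSupercuspidal.isAdmissible_holds`).

THE MATHEMATICS (no Hecke-algebra structure, no Jacquet module, no Satake isomorphism).
* (D1)∕(D2) «SC-NO-PARAHORIC» `V^{K₀} = V^{K₁} = 0` = the socket ★ `TreeAction.fixedPoints_eq_bot_of_isSupercuspidal_of_permHom` (a `K`-fixed eigenvector of the geometric
  distance-`2` operator would give a finitely supported «harmonic» function on one colour class of a leafless tree, which vanishes, ★ (T-H) §4) instantiated on the ★ lattice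
  tree `X = latticeGraph σ ϖ J₀` of road «S3-tree» (B-p14): the action `u ↦ latticeGraphPerm σ ϖ J₀ u` as a homomorphism `U →* Equiv.Perm W` (★ `mapGL_one`∕`mapGL_mul`), adjacency
  preserved (★ `latticeGraphIso`), `X` a tree (★ `isTree_latticeGraph_three_of_unramified`) and LEAFLESS (valencies ★ `ncard_neighborSet_eq_typeFun`), the stabilisers of the
  root `L₀ = 𝒪³` and of `N₁ = latt diag(1,1,ϖ)` are `K₀` and `K₁` (★ `mapGL_stdLattice_eq_iff_mem_glInt`), compact open (★ `LevelIndices` §2), vertices at distance `2` have the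
  same type and `U` is transitive on each type (★ `exists_latticeGraphIso_root_eq` ∕ `exists_latticeGraphIso_N₁_eq`), the distance-`2` spheres are finite (★ `finite_neighborSet`),
  `V^{K_i}` finite-dimensional by admissibility.
* (D3) «SC-NO-IWAHORI» `V^{I} = 0`: for `v ∈ V^I` and a smooth linear form `ℓ`, the EDGE FUNCTION `φ(u·L₀, u·N₁) := ℓ(ρ(u) v)` of the tree (well defined: `u` is determined by
  the oriented edge up to `I = Stab(L₀) ∩ Stab(N₁)`, which fixes `v`; a translate of `L₀` is never a translate of `N₁`) is symmetric, supported on edges and FINITELY supported (the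
  coefficient `u ↦ ℓ(ρ(u) v)` is compactly supported, ★ `IsSupercuspidal.hasCompactSupport_matrixCoeff`, and a compact set moves `L₀`, `N₁` to finitely many vertices, their
  stabilisers being open); its sum around `g·L₀` is `ℓ(ρ(g) Σ_{k ∈ K₀/I} ρ(k) v)` (the star of `L₀` is the `K₀`-orbit of `N₁`, ★ `setOf_orbit_conj_eq_image_neighborSet_root`) with
  `Σ_{k ∈ K₀/I} ρ(k) v ∈ V^{K₀} = 0` by (D1), and likewise around `g·N₁` by (D2) (★ `setOf_orbit_root_eq_image_neighborSet_N₁`); hence `φ = 0` by ★ (T-H) §2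
  `TreeHarmonic.eq_zero_of_forall_finsum_adj_eq_zero`, so `ℓ(v) = φ(L₀, N₁) = 0` for every smooth `ℓ`, and `v = 0` (`ℓ := ℓ₀ ∘ e_I` separates, ★ `exists_fixedPoints_projection`).

* §0 (generic, namespace `Representation`): `sum_quotient_out_apply_mem_fixedPoints_of_subgroup` (the sum of an `N`-fixed vector over representatives of `K ⧸ N` is `K`-fixed, for ANY
  subgroup `N ≤ K` of finite index — the ★ `sum_quotient_out_apply_mem_fixedPoints` asks `N` normal), `exists_mem_contragredient_apply_ne_zero_of_mem_fixedPoints` (a non-zero vector fixed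
  by a compact open subgroup is seen by a smooth linear form).
* §1 (the base edge of the lattice tree): `mem_glInt_subgroupOf_iff_latticeGraphPerm_root_eq`, `mem_conj_glInt_subgroupOf_iff_latticeGraphPerm_N₁_eq` (the stabilisers), `latticeGraph_adj_root_N₁`,
  `latticeGraphPerm_root_ne_latticeGraphPerm_N₁`, `finite_image_mapGL_of_isCompact`, `exists_mem_glInt_subgroupOf_latticeGraphPerm_N₁_eq_of_adj_root` ∕ `…_root_eq_of_adj_N₁` (stars =
  orbits, vertex form), `finite_setOf_dist_eq_two`, `exists_adj_adj_ne_latticeGraph_three` (leafless), `exists_latticeGraphPerm_eq_of_dist_eq_two`, `latticeGraphPerm_one_apply`, `latticeGraphPerm_mul_apply`.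
* §2 **`fixedPoints_eq_bot_of_isSupercuspidal_of_forall_mem_iff_latticeGraphPerm_eq`** (any vertex stabiliser), **`fixedPoints_glInt_subgroupOf_eq_bot_of_isSupercuspidal`** (D1, `K₀`),
  **`fixedPoints_conj_glInt_subgroupOf_eq_bot_of_isSupercuspidal`** (D2, `K₁`).
* §3 **`fixedPoints_glInt_inf_conj_glInt_subgroupOf_eq_bot_of_isSupercuspidal`** (D3, the Iwahori `K₀ ⊓ K₁`).

CONSUMER-IN-WAITING (census EP-G §3 K3): `Tr σ(f_EP^G) = dim σ^{K₀} + dim σ^{K₁} − dim σ^{I} = 0` for `σ` supercuspidal — the K3 instances «supercuspidal against `St(ψ)` ∕ `ψ∘det`»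
of the rung-0 block, through (G3)∕(G4); and every later statement about Iwahori- or parahoric-fixed vectors of supercuspidals of `U(3)` (reading on `Gqs L v` = one ★ `localNonsplitEquiv`
line, levels pulled back by membership as in ★ `UnitaryLatticeTreePeriodRelation`).  HONEST LABEL: count-neutral rule-20 brick (closes no node; pays K3's sc-instances only at t1′); h413
OPEN; HC_CM is proved only modulo the 7 printed citations (2 remaining named inputs hLiu418 = stmt-HodgeConjecture-24832, h413 = stmt-HodgeConjecture-24833) until rung 0 closes.  Nothing
printed is asserted: the printed statements cited ([Borel1976, 4.7], [Casselman1995, Prop. 3.3.6]: «`V^I ↪ V_N`», hence `V^I = 0` for supercuspidal `V`) are PROVED here for the unramified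
`U(3)` by a different (tree-harmonic) argument.

## References
* [Borel1976] A. Borel, *Admissible representations of a semi-simple group over a local field with vectors fixed under an Iwahori subgroup*, Invent. Math. 35 (1976), §4 (Lemma 4.7).
* [Casselman1995] W. Casselman, *Introduction to the theory of admissible representations of p-adic reductive groups* (1995 notes), §2.1 (the projector `e_K`), §3.3 (Prop. 3.3.6).
* [Serre1980Trees] J.-P. Serre, *Trees* (1980), Ch. I §2.2–2.3, Ch. II §1.1–1.3 (lattice trees, vertex and edge stabilisers).
* [BruhatTits1972] F. Bruhat, J. Tits, *Groupes réductifs sur un corps local I*, Publ. Math. IHÉS 41 (1972), (4.4.4), §10 (unitary groups; the Iwahori as the stabiliser of an edge).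
* [Tits1979] J. Tits, *Reductive groups over local fields*, PSPM 33.1 (1979), §2.4 (local index `(q³+1, q+1)` of the quasi-split `²A₂`), §3.2, §3.5.
* [Kottwitz1988] R. E. Kottwitz, *Tamagawa numbers*, Ann. of Math. 127 (1988), §2 (the levels `K₀`, `K₁`, `I` and the Euler–Poincaré function of a rank-one group).
-/

set_option autoImplicit false

noncomputable section

open Matrix Literature.NumberTheory.Automorphic Literature.Combinatorics.SimpleGraph
open Literature.NumberTheory.Automorphic.HermitianLattice Literature.NumberTheory.Automorphic.UnitaryGroup Literature.NumberTheory.Automorphic.CartanUnique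
open scoped Matrix MatrixGroups WithZero Valued


/-! ## §0 Generic representation-theoretic helpers -/

namespace Representation

variable {k G V : Type*} [Field k] [Group G] [AddCommGroup V] [Module k V] (ρ : Representation k G V)

/-- **The sum over coset representatives of a subgroup `N ≤ K` (not necessarily normal) of an `N`-fixed vector is `K`-fixed**: left multiplication by
`g ∈ K` permutes `K ⧸ N` and changes each representative by an element of `N` on the right. [cite: Casselman1995, §2.1] [cite: BernsteinZelevinsky1976, §2.1] -/
theorem sum_quotient_out_apply_mem_fixedPoints_of_subgroup {K : Subgroup G} (N : Subgroup K) [Fintype (K ⧸ N)] {u : V}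
    (hu : ∀ n ∈ N, ρ ((n : K) : G) u = u) :
    (∑ q : K ⧸ N, ρ ((q.out : K) : G) u) ∈ ρ.fixedPoints K := by
  rw [mem_fixedPoints]
  intro g hg
  rw [map_sum]
  refine Fintype.sum_equiv (MulAction.toPerm (⟨g, hg⟩ : K)) _ _ fun q => ?_
  rw [MulAction.toPerm_apply, ← Module.End.mul_apply, ← map_mul]
  have hcoe : g * ((q.out : K) : G) = (((⟨g, hg⟩ : K) * q.out : K) : G) := rfl
  rw [hcoe]
  refine ρ.apply_eq_apply_of_quotient_eq N hu ?_
  rw [QuotientGroup.out_eq']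
  exact MulAction.Quotient.coe_smul_out N (⟨g, hg⟩ : K) q

variable [CharZero k] [TopologicalSpace G] [IsTopologicalGroup G]

/-- **A non-zero vector fixed by a compact subgroup is detected by a smooth linear form**: if `v ≠ 0` is `I`-fixed, `I` compact, `ρ` smooth, then some
`ℓ ∈ Ṽ` (the smooth contragredient) has `ℓ v ≠ 0` — take any linear form not vanishing at `v` and precompose with the `I`-averaging projector onto `V^I`
(which fixes `v` and is `I`-invariant, so the composite is fixed by the open subgroup `I`). [cite: Casselman1995, §2.1] [cite: BernsteinZelevinsky1976, §2.1] -/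
theorem exists_mem_contragredient_apply_ne_zero_of_mem_fixedPoints {ρ : Representation k G V} (hρ : ρ.IsSmooth) {I : Subgroup G}
    (hIc : IsCompact (I : Set G)) (hIo : IsOpen (I : Set G)) {v : V} (hv : v ∈ ρ.fixedPoints I) (hv0 : v ≠ 0) :
    ∃ ℓ : Module.Dual k V, ℓ ∈ ρ.contragredient ∧ ℓ v ≠ 0 := by
  obtain ⟨ℓ₀, hℓ₀⟩ := Module.Projective.exists_dual_ne_zero k hv0
  obtain ⟨e, -, he₂, he₃⟩ := hρ.exists_fixedPoints_projection hIc
  refine ⟨ℓ₀ ∘ₗ e, ?_, ?_⟩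
  · refine ρ.dual.isSmoothVector_of_le hIo fun g hg => ?_
    rw [Representation.mem_stabilizerSubgroup]
    ext x
    simp only [Representation.dual_apply, Module.Dual.transpose_apply, LinearMap.comp_apply]
    rw [he₃ _ (Subgroup.inv_mem _ hg)]
  · rw [LinearMap.comp_apply, he₂ v hv]
    exact hℓ₀

end Representation

/-! ## §1 The lattice tree of `U(Φ₃)`: the base edge `{L₀, N₁}`, its stabilisers `K₀, K₁`, finiteness of compact orbits -/

namespace Literature.NumberTheory.Automorphic.UnitaryLatticeTree

variable {K : Type*} [Field K] [Valued K ℤᵐ⁰] [ValuativeRel K] [(Valued.v : Valuation K ℤᵐ⁰).Compatible]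
variable {σ : K →+* K} {ϖ : K}

/-- `u ∈ K₀ = (GL₃(𝒪)).subgroupOf U` iff `u` fixes the root vertex `L₀ = 𝒪³` (★ `mapGL_stdLattice_eq_iff_mem_glInt`, vertex form). [cite: Serre1980Trees, Ch. II §1.1] -/
theorem mem_glInt_subgroupOf_iff_latticeGraphPerm_root_eq (hd : UnramifiedLocalConjDatum σ ϖ) (u : ↥(unitaryGroupOfForm σ ((StdForm.antidiagonal 3).over K))) :
    u ∈ (glInt 3 K).subgroupOf (unitaryGroupOfForm σ ((StdForm.antidiagonal 3).over K)) ↔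
      latticeGraphPerm σ ϖ ((StdForm.antidiagonal 3).over K) u ⟨stdLattice K 3, 0, isSelfDualLattice_stdLattice_three hd⟩ =
        ⟨stdLattice K 3, 0, isSelfDualLattice_stdLattice_three hd⟩ := by
  rw [Subgroup.mem_subgroupOf, ← mapGL_stdLattice_eq_iff_mem_glInt]
  exact ⟨fun h => Subtype.ext h, fun h => congrArg Subtype.val h⟩

/-- `u ∈ K₁ = (g₁ GL₃(𝒪) g₁⁻¹).subgroupOf U` (`g₁ = diag(1,1,ϖ)`) iff `u` fixes the type-two vertex `N₁ = g₁·L₀ = latt diag(1,1,ϖ)`. [cite: BruhatTits1972, §10] [cite: Serre1980Trees, Ch. II §1.1] -/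
theorem mem_conj_glInt_subgroupOf_iff_latticeGraphPerm_N₁_eq (hd : UnramifiedLocalConjDatum σ ϖ) (g₁ : GL (Fin 3) K)
    (hg₁ : (g₁ : Matrix (Fin 3) (Fin 3) K) = Matrix.diagonal ![(1 : K), 1, ϖ]) (u : ↥(unitaryGroupOfForm σ ((StdForm.antidiagonal 3).over K))) :
    u ∈ ((glInt 3 K).map (MulAut.conj g₁).toMonoidHom).subgroupOf (unitaryGroupOfForm σ ((StdForm.antidiagonal 3).over K)) ↔
      latticeGraphPerm σ ϖ ((StdForm.antidiagonal 3).over K) u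
          ⟨latt (Matrix.diagonal ![(1 : K), 1, ϖ]), 2, isVertexLattice_two_latt_diagonal_one_one hd.σϖ (uniformizer_mem_integer hd.vϖ) (uniformizer_ne_zero hd.vϖ)⟩ =
        ⟨latt (Matrix.diagonal ![(1 : K), 1, ϖ]), 2, isVertexLattice_two_latt_diagonal_one_one hd.σϖ (uniformizer_mem_integer hd.vϖ) (uniformizer_ne_zero hd.vϖ)⟩ := by
  have hN₁ : mapGL g₁ (stdLattice K 3) = latt (Matrix.diagonal ![(1 : K), 1, ϖ]) := by rw [← hg₁]; rfl
  rw [Subgroup.mem_subgroupOf, Subgroup.mem_map_equiv, MulAut.conj_symm_apply, ← mapGL_stdLattice_eq_iff_mem_glInt,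
    ← (mapGL_injective g₁).eq_iff, ← mapGL_mul, show g₁ * (g₁⁻¹ * (u : GL (Fin 3) K) * g₁) = (u : GL (Fin 3) K) * g₁ by group, mapGL_mul, hN₁]
  exact ⟨fun h => Subtype.ext h, fun h => congrArg Subtype.val h⟩

omit [ValuativeRel K] [(Valued.v : Valuation K ℤᵐ⁰).Compatible] in
/-- **The base edge**: the root `L₀ = 𝒪³` and `N₁ = latt diag(1,1,ϖ)` are adjacent in the lattice graph (`N₁ < L₀`, ★ `mapGL_N₁_lt_stdLattice`). [cite: BruhatTits1972, §10] [cite: Serre1980Trees, Ch. II §1.1] -/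
theorem latticeGraph_adj_root_N₁ (hd : UnramifiedLocalConjDatum σ ϖ) :
    (latticeGraph σ ϖ ((StdForm.antidiagonal 3).over K)).Adj ⟨stdLattice K 3, 0, isSelfDualLattice_stdLattice_three hd⟩
      ⟨latt (Matrix.diagonal ![(1 : K), 1, ϖ]), 2, isVertexLattice_two_latt_diagonal_one_one hd.σϖ (uniformizer_mem_integer hd.vϖ) (uniformizer_ne_zero hd.vϖ)⟩ := by
  have hlt : latt (Matrix.diagonal ![(1 : K), 1, ϖ]) < stdLattice K 3 := by
    have h := mapGL_N₁_lt_stdLattice hd (Subgroup.one_mem (unitaryInt σ ((StdForm.antidiagonal 3).over K)))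
    rwa [Subgroup.coe_one, mapGL_one] at h
  exact (mem_neighborSet_root_iff hd _).2 hlt

omit [ValuativeRel K] [(Valued.v : Valuation K ℤᵐ⁰).Compatible] in
/-- A translate of the root is never a translate of `N₁` (self-dual versus type two). [cite: BruhatTits1972, §10] -/
theorem latticeGraphPerm_root_ne_latticeGraphPerm_N₁ (hd : UnramifiedLocalConjDatum σ ϖ) (u u' : ↥(unitaryGroupOfForm σ ((StdForm.antidiagonal 3).over K))) :
    latticeGraphPerm σ ϖ ((StdForm.antidiagonal 3).over K) u ⟨stdLattice K 3, 0, isSelfDualLattice_stdLattice_three hd⟩ ≠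
      latticeGraphPerm σ ϖ ((StdForm.antidiagonal 3).over K) u'
        ⟨latt (Matrix.diagonal ![(1 : K), 1, ϖ]), 2, isVertexLattice_two_latt_diagonal_one_one hd.σϖ (uniformizer_mem_integer hd.vϖ) (uniformizer_ne_zero hd.vϖ)⟩ := by
  intro h
  have h' := congrArg Subtype.val h
  change mapGL (u : GL (Fin 3) K) (stdLattice K 3) = mapGL (u' : GL (Fin 3) K) (latt (Matrix.diagonal ![(1 : K), 1, ϖ])) at h'
  have hsd : IsSelfDualLattice σ ϖ ((StdForm.antidiagonal 3).over K) (mapGL (u : GL (Fin 3) K) (stdLattice K 3)) :=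
    isVertexLattice_mapGL σ ϖ _ _ u.2 (isSelfDualLattice_stdLattice_three hd)
  have h2 : IsVertexLattice σ ϖ ((StdForm.antidiagonal 3).over K) 2 (mapGL (u' : GL (Fin 3) K) (latt (Matrix.diagonal ![(1 : K), 1, ϖ]))) :=
    isVertexLattice_mapGL σ ϖ _ _ u'.2 (isVertexLattice_two_latt_diagonal_one_one hd.σϖ (uniformizer_mem_integer hd.vϖ) (uniformizer_ne_zero hd.vϖ))
  rw [h'] at hsd
  exact not_isSelfDualLattice_of_isVertexLattice_two hd h2 hsd

omit [ValuativeRel K] [(Valued.v : Valuation K ℤᵐ⁰).Compatible] in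
/-- **A compact set of `U(σ, H)` moves a lattice with open stabiliser to only finitely many lattices** (the orbit map factors through the discrete quotient by the open
stabiliser; a compact subset of a discrete space is finite). [cite: Serre1980Trees, Ch. II §1.1] [folklore] -/
theorem finite_image_mapGL_of_isCompact {N : ℕ} {H : Matrix (Fin N) (Fin N) K} (S : Subgroup ↥(unitaryGroupOfForm σ H)) (hS : IsOpen (S : Set ↥(unitaryGroupOfForm σ H)))
    (M : Submodule 𝒪[K] (Fin N → K)) (hM : ∀ u : ↥(unitaryGroupOfForm σ H), u ∈ S → mapGL (u : GL (Fin N) K) M = M)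
    {C : Set ↥(unitaryGroupOfForm σ H)} (hC : IsCompact C) :
    Set.Finite ((fun u : ↥(unitaryGroupOfForm σ H) => mapGL (u : GL (Fin N) K) M) '' C) := by
  classical
  haveI : DiscreteTopology (↥(unitaryGroupOfForm σ H) ⧸ S) := QuotientGroup.discreteTopology hS
  have hq : IsCompact ((QuotientGroup.mk : ↥(unitaryGroupOfForm σ H) → ↥(unitaryGroupOfForm σ H) ⧸ S) '' C) :=
    hC.image continuous_quot_mk
  have hfin : Set.Finite ((QuotientGroup.mk : ↥(unitaryGroupOfForm σ H) → ↥(unitaryGroupOfForm σ H) ⧸ S) '' C) := hq.finite_of_discrete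
  have hfac : ∀ u u' : ↥(unitaryGroupOfForm σ H), (QuotientGroup.mk u : ↥(unitaryGroupOfForm σ H) ⧸ S) = QuotientGroup.mk u' →
      mapGL (u : GL (Fin N) K) M = mapGL (u' : GL (Fin N) K) M := by
    intro u u' h
    rw [QuotientGroup.eq] at h
    have h2 := hM _ h
    rw [Subgroup.coe_mul, Subgroup.coe_inv, mapGL_mul] at h2
    have h3 := congrArg (mapGL (u : GL (Fin N) K)) h2
    rw [← mapGL_mul, ← mapGL_mul, mul_inv_cancel, one_mul] at h3
    exact h3.symm
  refine (hfin.image (Quotient.lift (fun u : ↥(unitaryGroupOfForm σ H) => mapGL (u : GL (Fin N) K) M)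
    (fun a b hab => hfac a b (Quotient.sound hab)))).subset ?_
  rintro _ ⟨u, hu, rfl⟩
  exact ⟨QuotientGroup.mk u, ⟨u, hu, rfl⟩, rfl⟩

/-- **The star of the root is the `K₀`-orbit of `N₁`, vertex form** (★ `setOf_orbit_conj_eq_image_neighborSet_root`). [cite: BruhatTits1972, (4.4.4)] [cite: Serre1980Trees, Ch. II §1.1] -/
theorem exists_mem_glInt_subgroupOf_latticeGraphPerm_N₁_eq_of_adj_root (hd : UnramifiedLocalConjDatum σ ϖ) (g₁ : GL (Fin 3) K)
    (hg₁ : (g₁ : Matrix (Fin 3) (Fin 3) K) = Matrix.diagonal ![(1 : K), 1, ϖ])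
    {w : {M : Submodule 𝒪[K] (Fin 3 → K) // IsVertex σ ϖ ((StdForm.antidiagonal 3).over K) M}}
    (hw : (latticeGraph σ ϖ ((StdForm.antidiagonal 3).over K)).Adj ⟨stdLattice K 3, 0, isSelfDualLattice_stdLattice_three hd⟩ w) :
    ∃ k : ↥(unitaryGroupOfForm σ ((StdForm.antidiagonal 3).over K)), k ∈ (glInt 3 K).subgroupOf (unitaryGroupOfForm σ ((StdForm.antidiagonal 3).over K)) ∧
      latticeGraphPerm σ ϖ ((StdForm.antidiagonal 3).over K) k
          ⟨latt (Matrix.diagonal ![(1 : K), 1, ϖ]), 2, isVertexLattice_two_latt_diagonal_one_one hd.σϖ (uniformizer_mem_integer hd.vϖ) (uniformizer_ne_zero hd.vϖ)⟩ = w := by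
  have hN₁ : mapGL g₁ (stdLattice K 3) = latt (Matrix.diagonal ![(1 : K), 1, ϖ]) := by rw [← hg₁]; rfl
  have hmem : w.1 ∈ Subtype.val '' ((latticeGraph σ ϖ ((StdForm.antidiagonal 3).over K)).neighborSet ⟨stdLattice K 3, 0, isSelfDualLattice_stdLattice_three hd⟩) :=
    ⟨w, hw, rfl⟩
  rw [← setOf_orbit_conj_eq_image_neighborSet_root hd g₁ hg₁] at hmem
  obtain ⟨k, hk, hkw⟩ := hmem
  refine ⟨k, hk, Subtype.ext ?_⟩
  change mapGL (k : GL (Fin 3) K) (latt (Matrix.diagonal ![(1 : K), 1, ϖ])) = w.1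
  rw [← hN₁, ← mapGL_mul, hkw]

/-- **The star of `N₁` is the `K₁`-orbit of the root, vertex form** (★ `setOf_orbit_root_eq_image_neighborSet_N₁`). [cite: BruhatTits1972, §10] [cite: Serre1980Trees, Ch. II §1.1] -/
theorem exists_mem_conj_glInt_subgroupOf_latticeGraphPerm_root_eq_of_adj_N₁ (hd : UnramifiedLocalConjDatum σ ϖ) (g₁ : GL (Fin 3) K)
    (hg₁ : (g₁ : Matrix (Fin 3) (Fin 3) K) = Matrix.diagonal ![(1 : K), 1, ϖ])
    {w : {M : Submodule 𝒪[K] (Fin 3 → K) // IsVertex σ ϖ ((StdForm.antidiagonal 3).over K) M}}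
    (hw : (latticeGraph σ ϖ ((StdForm.antidiagonal 3).over K)).Adj
      ⟨latt (Matrix.diagonal ![(1 : K), 1, ϖ]), 2, isVertexLattice_two_latt_diagonal_one_one hd.σϖ (uniformizer_mem_integer hd.vϖ) (uniformizer_ne_zero hd.vϖ)⟩ w) :
    ∃ k : ↥(unitaryGroupOfForm σ ((StdForm.antidiagonal 3).over K)),
      k ∈ ((glInt 3 K).map (MulAut.conj g₁).toMonoidHom).subgroupOf (unitaryGroupOfForm σ ((StdForm.antidiagonal 3).over K)) ∧
      latticeGraphPerm σ ϖ ((StdForm.antidiagonal 3).over K) k ⟨stdLattice K 3, 0, isSelfDualLattice_stdLattice_three hd⟩ = w := by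
  have hmem : w.1 ∈ Subtype.val '' ((latticeGraph σ ϖ ((StdForm.antidiagonal 3).over K)).neighborSet
      ⟨latt (Matrix.diagonal ![(1 : K), 1, ϖ]), 2, isVertexLattice_two_latt_diagonal_one_one hd.σϖ (uniformizer_mem_integer hd.vϖ) (uniformizer_ne_zero hd.vϖ)⟩) :=
    ⟨w, hw, rfl⟩
  rw [← setOf_orbit_root_eq_image_neighborSet_N₁ hd g₁ hg₁] at hmem
  obtain ⟨k, hk, hkw⟩ := hmem
  exact ⟨k, hk, Subtype.ext hkw⟩

omit [ValuativeRel K] [(Valued.v : Valuation K ℤᵐ⁰).Compatible] in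
/-- **Every star of the lattice tree is FINITE, residue-field form** (★ `finite_neighborSet`), hence every distance-`2` sphere is finite (a distance-`2` vertex is a neighbour of a
neighbour, ★ `TreeHarmonic.exists_adj_adj_of_dist_eq_two`). [cite: Serre1980Trees, Ch. II §1.1] [cite: BruhatTits1972, §10] -/
theorem finite_setOf_dist_eq_two (hd : UnramifiedLocalConjDatum σ ϖ) (hσO : ∀ x : 𝒪[K], σ x ∈ 𝒪[K]) (σk : 𝓀[K] →+* 𝓀[K])
    (hσk : ∀ x : 𝒪[K], IsLocalRing.residue 𝒪[K] ⟨σ x, hσO x⟩ = σk (IsLocalRing.residue 𝒪[K] x)) [Finite 𝓀[K]]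
    (x₀ : {M : Submodule 𝒪[K] (Fin 3 → K) // IsVertex σ ϖ ((StdForm.antidiagonal 3).over K) M}) :
    Set.Finite {y | (latticeGraph σ ϖ ((StdForm.antidiagonal 3).over K)).dist x₀ y = 2} := by
  refine ((finite_neighborSet hd hσO σk hσk x₀).biUnion fun z _ => finite_neighborSet hd hσO σk hσk z).subset ?_
  intro y hy
  obtain ⟨s, hxs, hsy, -⟩ := TreeHarmonic.exists_adj_adj_of_dist_eq_two (isTree_latticeGraph_three_of_unramified hd) hy
  exact Set.mem_biUnion hxs hsy

omit [ValuativeRel K] [(Valued.v : Valuation K ℤᵐ⁰).Compatible] in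
/-- **The lattice tree is LEAFLESS**: every vertex has two distinct neighbours (valencies `q³ + 1` and `q + 1` with `q ≥ 1`, ★ `ncard_neighborSet_eq_typeFun`).
[cite: Tits1979, §2.4] [cite: Serre1980Trees, Ch. II §1.1] -/
theorem exists_adj_adj_ne_latticeGraph_three (hd : UnramifiedLocalConjDatum σ ϖ) (hσO : ∀ x : 𝒪[K], σ x ∈ 𝒪[K]) (σk : 𝓀[K] →+* 𝓀[K])
    (hσk : ∀ x : 𝒪[K], IsLocalRing.residue 𝒪[K] ⟨σ x, hσO x⟩ = σk (IsLocalRing.residue 𝒪[K] x))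
    [Fintype 𝓀[K]] {q : ℕ} (hk : Fintype.card 𝓀[K] = q ^ 2) (hfrob : ∀ y, σk y = y ^ q)
    (w : {M : Submodule 𝒪[K] (Fin 3 → K) // IsVertex σ ϖ ((StdForm.antidiagonal 3).over K) M}) :
    ∃ w₁ w₂, w₁ ≠ w₂ ∧ (latticeGraph σ ϖ ((StdForm.antidiagonal 3).over K)).Adj w w₁ ∧ (latticeGraph σ ϖ ((StdForm.antidiagonal 3).over K)).Adj w w₂ := by
  classical
  obtain ⟨c, hc0⟩ := exists_typeFun (K := K) (σ := σ) (ϖ := ϖ)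
  have hq : 1 ≤ q := by
    rcases Nat.eq_zero_or_pos q with h | h
    · exfalso
      have h1 : 1 < Fintype.card 𝓀[K] := Fintype.one_lt_card
      rw [hk, h] at h1
      exact absurd h1 (by norm_num)
    · exact h
  have hcard := ncard_neighborSet_eq_typeFun hd hσO σk hσk hk hfrob hc0 w
  have h2 : 1 < ((latticeGraph σ ϖ ((StdForm.antidiagonal 3).over K)).neighborSet w).ncard := by
    rw [hcard]
    have key : ∀ i : Fin 2, 1 ≤ (![q ^ 3, q] : Fin 2 → ℕ) i := by
      intro i
      fin_cases i
      · exact Nat.one_le_pow _ _ hq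
      · exact hq
    have := key (c w)
    omega
  obtain ⟨w₁, w₂, hw₁, hw₂, hne⟩ := (Set.one_lt_ncard_iff (finite_neighborSet hd hσO σk hσk w)).1 h2
  exact ⟨w₁, w₂, hne, hw₁, hw₂⟩

omit [ValuativeRel K] [(Valued.v : Valuation K ℤᵐ⁰).Compatible] in
/-- **Vertices at distance `2` have the same type**, hence are translates of one another: for every vertex `x₀` and every `y` with `dist x₀ y = 2` some `u ∈ U(σ, J₀)`
carries `x₀` to `y` (★ transitivity of `U(J₀)` on the self-dual and on the type-two vertices; the middle vertex has the other type, ★ `isSelfDualLattice_iff_not_isSelfDualLattice_of_adj`).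
[cite: BruhatTits1972, §10] [cite: Tits1979, §3.3.3] [cite: Serre1980Trees, Ch. II §1.1] -/
theorem exists_latticeGraphPerm_eq_of_dist_eq_two (hd : UnramifiedLocalConjDatum σ ϖ)
    (x₀ y : {M : Submodule 𝒪[K] (Fin 3 → K) // IsVertex σ ϖ ((StdForm.antidiagonal 3).over K) M})
    (hy : (latticeGraph σ ϖ ((StdForm.antidiagonal 3).over K)).dist x₀ y = 2) :
    ∃ u : ↥(unitaryGroupOfForm σ ((StdForm.antidiagonal 3).over K)), latticeGraphPerm σ ϖ ((StdForm.antidiagonal 3).over K) u x₀ = y := by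
  obtain ⟨s, hxs, hsy, -⟩ := TreeHarmonic.exists_adj_adj_of_dist_eq_two (isTree_latticeGraph_three_of_unramified hd) hy
  have h1 := isSelfDualLattice_iff_not_isSelfDualLattice_of_adj hd hxs
  have h2 := isSelfDualLattice_iff_not_isSelfDualLattice_of_adj hd hsy
  by_cases hx : IsSelfDualLattice σ ϖ ((StdForm.antidiagonal 3).over K) x₀.1
  · have hysd : IsSelfDualLattice σ ϖ ((StdForm.antidiagonal 3).over K) y.1 := by
      by_contra hyn; exact (h1.1 hx) (h2.2 hyn)
    obtain ⟨u, hu⟩ := exists_latticeGraphIso_root_eq hd x₀ hx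
    obtain ⟨u', hu'⟩ := exists_latticeGraphIso_root_eq hd y hysd
    refine ⟨u' * u⁻¹, ?_⟩
    change latticeGraphIso σ ϖ ((StdForm.antidiagonal 3).over K) (u' * u⁻¹) x₀ = y
    rw [← hu, ← hu']
    apply Subtype.ext
    simp only [latticeGraphIso_apply_val, Subgroup.coe_mul, Subgroup.coe_inv]
    rw [← mapGL_mul, mul_assoc, inv_mul_cancel, mul_one]
  · have hx2 := isVertexLattice_two_of_not_isSelfDualLattice hd x₀ hx
    have hs : IsSelfDualLattice σ ϖ ((StdForm.antidiagonal 3).over K) s.1 := by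
      by_contra hsn; exact hx (h1.2 hsn)
    have hyn : ¬ IsSelfDualLattice σ ϖ ((StdForm.antidiagonal 3).over K) y.1 := h2.1 hs
    have hy2 := isVertexLattice_two_of_not_isSelfDualLattice hd y hyn
    obtain ⟨u, hu⟩ := exists_latticeGraphIso_N₁_eq hd x₀ hx2
    obtain ⟨u', hu'⟩ := exists_latticeGraphIso_N₁_eq hd y hy2
    refine ⟨u' * u⁻¹, ?_⟩
    change latticeGraphIso σ ϖ ((StdForm.antidiagonal 3).over K) (u' * u⁻¹) x₀ = y
    rw [← hu, ← hu']
    apply Subtype.ext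
    simp only [latticeGraphIso_apply_val, Subgroup.coe_mul, Subgroup.coe_inv]
    rw [← mapGL_mul, mul_assoc, inv_mul_cancel, mul_one]

/-! ## §2 «SC-NO-PARAHORIC» at the two vertex stabilisers `K₀`, `K₁` of `U(Φ₃)` -/

omit [ValuativeRel K] [(Valued.v : Valuation K ℤᵐ⁰).Compatible] in
/-- **An ADMISSIBLE SUPERCUSPIDAL representation of `U(σ, J₀)` has no vector fixed by the stabiliser of a vertex of the lattice tree** (generic vertex form): the socket
★ `TreeAction.fixedPoints_eq_bot_of_isSupercuspidal_of_permHom` instantiated on the ★ `U(3)` lattice tree (action `u ↦ latticeGraphPerm σ ϖ J₀ u`, tree ★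
`isTree_latticeGraph_three_of_unramified`, leafless by the valencies, distance-two transitivity above, finite spheres), the centre of `U` being compact (`hZ`) and `S` a
compact open vertex stabiliser; `V^S` is finite-dimensional by admissibility. [cite: Casselman1995, §3.3] [cite: BruhatTits1972, §10] [cite: Serre1980Trees, Ch. II §1.1–1.3] -/
theorem fixedPoints_eq_bot_of_isSupercuspidal_of_forall_mem_iff_latticeGraphPerm_eq (hd : UnramifiedLocalConjDatum σ ϖ)
    (hσO : ∀ x : 𝒪[K], σ x ∈ 𝒪[K]) (σk : 𝓀[K] →+* 𝓀[K]) (hσk : ∀ x : 𝒪[K], IsLocalRing.residue 𝒪[K] ⟨σ x, hσO x⟩ = σk (IsLocalRing.residue 𝒪[K] x))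
    [Fintype 𝓀[K]] {q : ℕ} (hk : Fintype.card 𝓀[K] = q ^ 2) (hfrob : ∀ y, σk y = y ^ q)
    (x₀ : {M : Submodule 𝒪[K] (Fin 3 → K) // IsVertex σ ϖ ((StdForm.antidiagonal 3).over K) M})
    (S : Subgroup ↥(unitaryGroupOfForm σ ((StdForm.antidiagonal 3).over K)))
    (hS : ∀ u : ↥(unitaryGroupOfForm σ ((StdForm.antidiagonal 3).over K)), u ∈ S ↔ latticeGraphPerm σ ϖ ((StdForm.antidiagonal 3).over K) u x₀ = x₀)
    (hSc : IsCompact (S : Set ↥(unitaryGroupOfForm σ ((StdForm.antidiagonal 3).over K)))) (hSo : IsOpen (S : Set ↥(unitaryGroupOfForm σ ((StdForm.antidiagonal 3).over K))))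
    (hZ : IsCompact ((Subgroup.center ↥(unitaryGroupOfForm σ ((StdForm.antidiagonal 3).over K)) : Subgroup ↥(unitaryGroupOfForm σ ((StdForm.antidiagonal 3).over K))) :
      Set ↥(unitaryGroupOfForm σ ((StdForm.antidiagonal 3).over K))))
    {V : Type*} [AddCommGroup V] [Module ℂ V] (ρ : Representation ℂ ↥(unitaryGroupOfForm σ ((StdForm.antidiagonal 3).over K)) V)
    (hadm : ρ.IsAdmissible) (hsc : ρ.IsSupercuspidal) :
    ρ.fixedPoints S = ⊥ := by
  classical
  -- finite-dimensionality of `V^S` from admissibility at the compact open `S`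
  haveI : FiniteDimensional ℂ (ρ.fixedPoints S) := hadm.finite_fixedPoints ⟨S, hSo⟩ hSc
  -- the action as a homomorphism to the permutations of the vertices
  let act : ↥(unitaryGroupOfForm σ ((StdForm.antidiagonal 3).over K)) →*
      Equiv.Perm {M : Submodule 𝒪[K] (Fin 3 → K) // IsVertex σ ϖ ((StdForm.antidiagonal 3).over K) M} :=
    { toFun := fun u => latticeGraphPerm σ ϖ ((StdForm.antidiagonal 3).over K) u
      map_one' := Equiv.ext fun v => Subtype.ext (by
        change mapGL (((1 : ↥(unitaryGroupOfForm σ ((StdForm.antidiagonal 3).over K))) : GL (Fin 3) K)) v.1 = v.1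
        rw [Subgroup.coe_one, mapGL_one])
      map_mul' := fun u u' => Equiv.ext fun v => Subtype.ext (by
        change mapGL (((u * u' : ↥(unitaryGroupOfForm σ ((StdForm.antidiagonal 3).over K))) : GL (Fin 3) K)) v.1 =
          mapGL (u : GL (Fin 3) K) (mapGL (u' : GL (Fin 3) K) v.1)
        rw [Subgroup.coe_mul, mapGL_mul]) }
  have hact : ∀ u x, act u x = latticeGraphPerm σ ϖ ((StdForm.antidiagonal 3).over K) u x := fun _ _ => rfl
  -- the distance-2 sphere and a section
  obtain ⟨S₂, hS₂⟩ : ∃ S₂ : Finset {M : Submodule 𝒪[K] (Fin 3 → K) // IsVertex σ ϖ ((StdForm.antidiagonal 3).over K) M},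
      ∀ y, y ∈ S₂ ↔ (latticeGraph σ ϖ ((StdForm.antidiagonal 3).over K)).dist x₀ y = 2 :=
    ⟨(finite_setOf_dist_eq_two hd hσO σk hσk x₀).toFinset, fun y => by rw [Set.Finite.mem_toFinset]; rfl⟩
  have horb : ∀ y, (latticeGraph σ ϖ ((StdForm.antidiagonal 3).over K)).dist x₀ y = 2 →
      ∃ u : ↥(unitaryGroupOfForm σ ((StdForm.antidiagonal 3).over K)), act u x₀ = y :=
    fun y hy => exists_latticeGraphPerm_eq_of_dist_eq_two hd x₀ y hy
  let sec : {M : Submodule 𝒪[K] (Fin 3 → K) // IsVertex σ ϖ ((StdForm.antidiagonal 3).over K) M} → ↥(unitaryGroupOfForm σ ((StdForm.antidiagonal 3).over K)) :=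
    fun y => if hy : (latticeGraph σ ϖ ((StdForm.antidiagonal 3).over K)).dist x₀ y = 2 then (horb y hy).choose else 1
  have hsec : ∀ y ∈ S₂, act (sec y) x₀ = y := by
    intro y hy
    have hy' := (hS₂ y).1 hy
    simp only [sec, dif_pos hy']
    exact (horb y hy').choose_spec
  exact Literature.RepresentationTheory.TreeAction.fixedPoints_eq_bot_of_isSupercuspidal_of_permHom (isTree_latticeGraph_three_of_unramified hd) (exists_adj_adj_ne_latticeGraph_three hd hσO σk hσk hk hfrob)
    act (fun u x y => (latticeGraphIso σ ϖ ((StdForm.antidiagonal 3).over K) u).map_rel_iff') x₀ S (fun u => by rw [hS, hact]) hSc hSo horb S₂ hS₂ sec hsec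
    hZ ρ hadm.isSmooth hsc

/-- **(D1) «SC-NO-PARAHORIC» at the hyperspecial vertex stabiliser `K₀ = U ∩ GL₃(𝒪)`**: an admissible supercuspidal representation of `U(σ, J₀)` (unramified datum, compact centre)
has `V^{K₀} = ⊥`. [cite: Casselman1995, §3.3] [cite: BruhatTits1972, §10] [cite: Tits1979, §3.2] -/
theorem fixedPoints_glInt_subgroupOf_eq_bot_of_isSupercuspidal [CompactSpace 𝒪[K]] (hd : UnramifiedLocalConjDatum σ ϖ) (hσ : Continuous σ)
    (hσO : ∀ x : 𝒪[K], σ x ∈ 𝒪[K]) (σk : 𝓀[K] →+* 𝓀[K]) (hσk : ∀ x : 𝒪[K], IsLocalRing.residue 𝒪[K] ⟨σ x, hσO x⟩ = σk (IsLocalRing.residue 𝒪[K] x))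
    [Fintype 𝓀[K]] {q : ℕ} (hk : Fintype.card 𝓀[K] = q ^ 2) (hfrob : ∀ y, σk y = y ^ q)
    (hZ : IsCompact ((Subgroup.center ↥(unitaryGroupOfForm σ ((StdForm.antidiagonal 3).over K)) : Subgroup ↥(unitaryGroupOfForm σ ((StdForm.antidiagonal 3).over K))) :
      Set ↥(unitaryGroupOfForm σ ((StdForm.antidiagonal 3).over K))))
    {V : Type*} [AddCommGroup V] [Module ℂ V] (ρ : Representation ℂ ↥(unitaryGroupOfForm σ ((StdForm.antidiagonal 3).over K)) V)
    (hadm : ρ.IsAdmissible) (hsc : ρ.IsSupercuspidal) :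
    ρ.fixedPoints ((glInt 3 K).subgroupOf (unitaryGroupOfForm σ ((StdForm.antidiagonal 3).over K))) = ⊥ :=
  fixedPoints_eq_bot_of_isSupercuspidal_of_forall_mem_iff_latticeGraphPerm_eq hd hσO σk hσk hk hfrob ⟨stdLattice K 3, 0, isSelfDualLattice_stdLattice_three hd⟩ _
    (mem_glInt_subgroupOf_iff_latticeGraphPerm_root_eq hd) (isCompact_glInt_subgroupOf σ _ hσ) (isOpen_glInt_subgroupOf σ _) hZ ρ hadm hsc

/-- **(D2) «SC-NO-PARAHORIC» at the second vertex stabiliser `K₁ = U ∩ g₁ GL₃(𝒪) g₁⁻¹`** (`g₁ = diag(1,1,ϖ)`, the stabiliser of the type-two vertex `N₁ = g₁·L₀`): an admissible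
supercuspidal representation of `U(σ, J₀)` has `V^{K₁} = ⊥`. [cite: Casselman1995, §3.3] [cite: BruhatTits1972, §10] [cite: Tits1979, §3.5] -/
theorem fixedPoints_conj_glInt_subgroupOf_eq_bot_of_isSupercuspidal [CompactSpace 𝒪[K]] (hd : UnramifiedLocalConjDatum σ ϖ) (hσ : Continuous σ)
    (hσO : ∀ x : 𝒪[K], σ x ∈ 𝒪[K]) (σk : 𝓀[K] →+* 𝓀[K]) (hσk : ∀ x : 𝒪[K], IsLocalRing.residue 𝒪[K] ⟨σ x, hσO x⟩ = σk (IsLocalRing.residue 𝒪[K] x))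
    [Fintype 𝓀[K]] {q : ℕ} (hk : Fintype.card 𝓀[K] = q ^ 2) (hfrob : ∀ y, σk y = y ^ q)
    (g₁ : GL (Fin 3) K) (hg₁ : (g₁ : Matrix (Fin 3) (Fin 3) K) = Matrix.diagonal ![(1 : K), 1, ϖ])
    (hZ : IsCompact ((Subgroup.center ↥(unitaryGroupOfForm σ ((StdForm.antidiagonal 3).over K)) : Subgroup ↥(unitaryGroupOfForm σ ((StdForm.antidiagonal 3).over K))) :
      Set ↥(unitaryGroupOfForm σ ((StdForm.antidiagonal 3).over K))))
    {V : Type*} [AddCommGroup V] [Module ℂ V] (ρ : Representation ℂ ↥(unitaryGroupOfForm σ ((StdForm.antidiagonal 3).over K)) V)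
    (hadm : ρ.IsAdmissible) (hsc : ρ.IsSupercuspidal) :
    ρ.fixedPoints (((glInt 3 K).map (MulAut.conj g₁).toMonoidHom).subgroupOf (unitaryGroupOfForm σ ((StdForm.antidiagonal 3).over K))) = ⊥ :=
  fixedPoints_eq_bot_of_isSupercuspidal_of_forall_mem_iff_latticeGraphPerm_eq hd hσO σk hσk hk hfrob
    ⟨latt (Matrix.diagonal ![(1 : K), 1, ϖ]), 2, isVertexLattice_two_latt_diagonal_one_one hd.σϖ (uniformizer_mem_integer hd.vϖ) (uniformizer_ne_zero hd.vϖ)⟩ _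
    (mem_conj_glInt_subgroupOf_iff_latticeGraphPerm_N₁_eq hd g₁ hg₁) (isCompact_conj_glInt_subgroupOf σ _ g₁ hσ) (isOpen_conj_glInt_subgroupOf σ _ g₁) hZ ρ hadm hsc

omit [ValuativeRel K] [(Valued.v : Valuation K ℤᵐ⁰).Compatible] in
/-- The vertex action of `1` is the identity (★ `mapGL_one`). [cite: BruhatTits1972, §10] -/
theorem latticeGraphPerm_one_apply {N : ℕ} {H : Matrix (Fin N) (Fin N) K} (x : {M : Submodule 𝒪[K] (Fin N → K) // IsVertex σ ϖ H M}) :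
    latticeGraphPerm σ ϖ H 1 x = x :=
  Subtype.ext (by change mapGL (((1 : ↥(unitaryGroupOfForm σ H))) : GL (Fin N) K) x.1 = x.1; rw [Subgroup.coe_one, mapGL_one])

omit [ValuativeRel K] [(Valued.v : Valuation K ℤᵐ⁰).Compatible] in
/-- The vertex action is multiplicative (★ `mapGL_mul`). [cite: BruhatTits1972, §10] -/
theorem latticeGraphPerm_mul_apply {N : ℕ} {H : Matrix (Fin N) (Fin N) K} (u u' : ↥(unitaryGroupOfForm σ H)) (x : {M : Submodule 𝒪[K] (Fin N → K) // IsVertex σ ϖ H M}) :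
    latticeGraphPerm σ ϖ H (u * u') x = latticeGraphPerm σ ϖ H u (latticeGraphPerm σ ϖ H u' x) :=
  Subtype.ext (by
    change mapGL (((u * u' : ↥(unitaryGroupOfForm σ H))) : GL (Fin N) K) x.1 = mapGL (u : GL (Fin N) K) (mapGL (u' : GL (Fin N) K) x.1)
    rw [Subgroup.coe_mul, mapGL_mul])

/-! ## §3 «SC-NO-IWAHORI»: no vector fixed by the Iwahori subgroup `I = K₀ ⊓ K₁` -/

/-- **(D3) «SC-NO-IWAHORI».**  An admissible supercuspidal representation `ρ` of `U = U(σ, J₀)` (unramified datum, compact centre) has NO non-zero vector fixed by the Iwahori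
subgroup `I = K₀ ⊓ K₁` (the stabiliser of the base edge `{L₀, N₁}` of the lattice tree).  PROOF (the edge half of the tree-harmonic route): for `v ∈ V^I` and a smooth
linear form `ℓ`, the EDGE FUNCTION `φ(u·L₀, u·N₁) := ℓ(ρ(u) v)` is well defined (`u` is determined by the edge up to `I`, which fixes `v`; a translate of `L₀` is never a
translate of `N₁`), symmetric, supported on edges, and FINITELY supported (the coefficient `u ↦ ℓ(ρ(u) v)` is compactly supported, ★ `IsSupercuspidal.hasCompactSupport_matrixCoeff`,
and a compact set moves `L₀`, `N₁` to finitely many vertices); its sum around the vertex `g·L₀` is `ℓ(ρ(g) Σ_{k ∈ K₀/I} ρ(k) v)` with `Σ_{k ∈ K₀/I} ρ(k) v ∈ V^{K₀} = 0` by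
(D1) (the star of `L₀` is the `K₀`-orbit of `N₁`, ★ `setOf_orbit_conj_eq_image_neighborSet_root`), and likewise around `g·N₁` by (D2); so `φ = 0` by ★ (T-H)
`TreeHarmonic.eq_zero_of_forall_finsum_adj_eq_zero`, whence `ℓ(v) = φ(L₀, N₁) = 0` for every smooth `ℓ` and `v = 0`.
[cite: Casselman1995, §3.3] [cite: Serre1980Trees, Ch. II §1.1–1.3] [cite: BruhatTits1972, §10] [cite: Kottwitz1988, §2] -/
theorem fixedPoints_glInt_inf_conj_glInt_subgroupOf_eq_bot_of_isSupercuspidal [CompactSpace 𝒪[K]] (hd : UnramifiedLocalConjDatum σ ϖ) (hσ : Continuous σ)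
    (hσO : ∀ x : 𝒪[K], σ x ∈ 𝒪[K]) (σk : 𝓀[K] →+* 𝓀[K]) (hσk : ∀ x : 𝒪[K], IsLocalRing.residue 𝒪[K] ⟨σ x, hσO x⟩ = σk (IsLocalRing.residue 𝒪[K] x))
    [Fintype 𝓀[K]] {q : ℕ} (hk : Fintype.card 𝓀[K] = q ^ 2) (hfrob : ∀ y, σk y = y ^ q)
    (g₁ : GL (Fin 3) K) (hg₁ : (g₁ : Matrix (Fin 3) (Fin 3) K) = Matrix.diagonal ![(1 : K), 1, ϖ])
    (hZ : IsCompact ((Subgroup.center ↥(unitaryGroupOfForm σ ((StdForm.antidiagonal 3).over K)) : Subgroup ↥(unitaryGroupOfForm σ ((StdForm.antidiagonal 3).over K))) :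
      Set ↥(unitaryGroupOfForm σ ((StdForm.antidiagonal 3).over K))))
    {V : Type*} [AddCommGroup V] [Module ℂ V] (ρ : Representation ℂ ↥(unitaryGroupOfForm σ ((StdForm.antidiagonal 3).over K)) V)
    (hadm : ρ.IsAdmissible) (hsc : ρ.IsSupercuspidal) :
    ρ.fixedPoints ((glInt 3 K).subgroupOf (unitaryGroupOfForm σ ((StdForm.antidiagonal 3).over K)) ⊓
      ((glInt 3 K).map (MulAut.conj g₁).toMonoidHom).subgroupOf (unitaryGroupOfForm σ ((StdForm.antidiagonal 3).over K))) = ⊥ := by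
  classical
  -- the two vertex stabilisers have no fixed vector
  have h₀ := fixedPoints_glInt_subgroupOf_eq_bot_of_isSupercuspidal hd hσ hσO σk hσk hk hfrob hZ ρ hadm hsc
  have h₁ := fixedPoints_conj_glInt_subgroupOf_eq_bot_of_isSupercuspidal hd hσ hσO σk hσk hk hfrob g₁ hg₁ hZ ρ hadm hsc
  rw [Submodule.eq_bot_iff]
  intro v hv
  by_contra hv0
  -- names
  set K₀ : Subgroup ↥(unitaryGroupOfForm σ ((StdForm.antidiagonal 3).over K)) := (glInt 3 K).subgroupOf (unitaryGroupOfForm σ ((StdForm.antidiagonal 3).over K)) with hK₀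
  set K₁ : Subgroup ↥(unitaryGroupOfForm σ ((StdForm.antidiagonal 3).over K)) :=
    ((glInt 3 K).map (MulAut.conj g₁).toMonoidHom).subgroupOf (unitaryGroupOfForm σ ((StdForm.antidiagonal 3).over K)) with hK₁
  have hvI := (ρ.mem_fixedPoints _ v).1 hv
  -- the compact open Iwahori and a smooth linear form seeing `v`
  have hIc : IsCompact ((K₀ ⊓ K₁ : Subgroup ↥(unitaryGroupOfForm σ ((StdForm.antidiagonal 3).over K))) : Set ↥(unitaryGroupOfForm σ ((StdForm.antidiagonal 3).over K))) := isCompact_glInt_inf_conj_glInt_subgroupOf σ ((StdForm.antidiagonal 3).over K) g₁ hσ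
  have hIo : IsOpen ((K₀ ⊓ K₁ : Subgroup ↥(unitaryGroupOfForm σ ((StdForm.antidiagonal 3).over K))) : Set ↥(unitaryGroupOfForm σ ((StdForm.antidiagonal 3).over K))) := isOpen_glInt_inf_conj_glInt_subgroupOf σ ((StdForm.antidiagonal 3).over K) g₁
  obtain ⟨ℓ, hℓ, hℓv⟩ := Representation.exists_mem_contragredient_apply_ne_zero_of_mem_fixedPoints hadm.isSmooth hIc hIo hv hv0
  have hcs : HasCompactSupport (ρ.matrixCoeff ℓ v) := hsc.hasCompactSupport_matrixCoeff hZ hℓ v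
  -- the base edge
  set r : {M : Submodule 𝒪[K] (Fin 3 → K) // IsVertex σ ϖ ((StdForm.antidiagonal 3).over K) M} := ⟨stdLattice K 3, 0, isSelfDualLattice_stdLattice_three hd⟩ with hr
  set n : {M : Submodule 𝒪[K] (Fin 3 → K) // IsVertex σ ϖ ((StdForm.antidiagonal 3).over K) M} :=
    ⟨latt (Matrix.diagonal ![(1 : K), 1, ϖ]), 2, isVertexLattice_two_latt_diagonal_one_one hd.σϖ (uniformizer_mem_integer hd.vϖ) (uniformizer_ne_zero hd.vϖ)⟩ with hn
  have hK₀r : ∀ u : ↥(unitaryGroupOfForm σ ((StdForm.antidiagonal 3).over K)), u ∈ K₀ ↔ latticeGraphPerm σ ϖ ((StdForm.antidiagonal 3).over K) u r = r := mem_glInt_subgroupOf_iff_latticeGraphPerm_root_eq hd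
  have hK₁n : ∀ u : ↥(unitaryGroupOfForm σ ((StdForm.antidiagonal 3).over K)), u ∈ K₁ ↔ latticeGraphPerm σ ϖ ((StdForm.antidiagonal 3).over K) u n = n := mem_conj_glInt_subgroupOf_iff_latticeGraphPerm_N₁_eq hd g₁ hg₁
  have hrn : ∀ u u' : ↥(unitaryGroupOfForm σ ((StdForm.antidiagonal 3).over K)), latticeGraphPerm σ ϖ ((StdForm.antidiagonal 3).over K) u r ≠ latticeGraphPerm σ ϖ ((StdForm.antidiagonal 3).over K) u' n :=
    latticeGraphPerm_root_ne_latticeGraphPerm_N₁ hd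
  -- the edge predicate and the edge function
  let P : ↥(unitaryGroupOfForm σ ((StdForm.antidiagonal 3).over K)) → {M : Submodule 𝒪[K] (Fin 3 → K) // IsVertex σ ϖ ((StdForm.antidiagonal 3).over K) M} →
      {M : Submodule 𝒪[K] (Fin 3 → K) // IsVertex σ ϖ ((StdForm.antidiagonal 3).over K) M} → Prop := fun u x y =>
    (latticeGraphPerm σ ϖ ((StdForm.antidiagonal 3).over K) u r = x ∧ latticeGraphPerm σ ϖ ((StdForm.antidiagonal 3).over K) u n = y) ∨
    (latticeGraphPerm σ ϖ ((StdForm.antidiagonal 3).over K) u r = y ∧ latticeGraphPerm σ ϖ ((StdForm.antidiagonal 3).over K) u n = x)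
  let φ : {M : Submodule 𝒪[K] (Fin 3 → K) // IsVertex σ ϖ ((StdForm.antidiagonal 3).over K) M} →
      {M : Submodule 𝒪[K] (Fin 3 → K) // IsVertex σ ϖ ((StdForm.antidiagonal 3).over K) M} → ℂ := fun x y =>
    if h : ∃ u, P u x y then ℓ (ρ h.choose v) else 0
  -- (a) same edge, same orientation ⇒ same value of `ρ(·) v`
  have hsame : ∀ u u' : ↥(unitaryGroupOfForm σ ((StdForm.antidiagonal 3).over K)), latticeGraphPerm σ ϖ ((StdForm.antidiagonal 3).over K) u r = latticeGraphPerm σ ϖ ((StdForm.antidiagonal 3).over K) u' r →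
      latticeGraphPerm σ ϖ ((StdForm.antidiagonal 3).over K) u n = latticeGraphPerm σ ϖ ((StdForm.antidiagonal 3).over K) u' n → ρ u v = ρ u' v := by
    intro u u' hrr hnn
    have hmem : u⁻¹ * u' ∈ K₀ ⊓ K₁ := by
      refine Subgroup.mem_inf.2 ⟨(hK₀r _).2 ?_, (hK₁n _).2 ?_⟩
      · rw [latticeGraphPerm_mul_apply, ← hrr, ← latticeGraphPerm_mul_apply, inv_mul_cancel, latticeGraphPerm_one_apply]
      · rw [latticeGraphPerm_mul_apply, ← hnn, ← latticeGraphPerm_mul_apply, inv_mul_cancel, latticeGraphPerm_one_apply]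
    have h := hvI _ hmem
    rw [map_mul, Module.End.mul_apply] at h
    calc ρ u v = ρ u (ρ u⁻¹ (ρ u' v)) := by rw [h]
      _ = ρ u' v := by rw [← Module.End.mul_apply, ← map_mul, mul_inv_cancel, map_one, Module.End.one_apply]
  have hval : ∀ u u' x y, P u x y → P u' x y → ρ u v = ρ u' v := by
    rintro u u' x y (⟨h1, h2⟩ | ⟨h1, h2⟩) (⟨h1', h2'⟩ | ⟨h1', h2'⟩)
    · exact hsame u u' (h1.trans h1'.symm) (h2.trans h2'.symm)
    · exact absurd (h1.trans h2'.symm) (hrn u u')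
    · exact absurd (h1'.trans h2.symm) (hrn u' u)
    · exact hsame u u' (h1.trans h1'.symm) (h2.trans h2'.symm)
  have hφP : ∀ u x y, P u x y → φ x y = ℓ (ρ u v) := by
    intro u x y hP
    have hex : ∃ u, P u x y := ⟨u, hP⟩
    simp only [φ, dif_pos hex]
    rw [hval _ _ x y hex.choose_spec hP]
  have hφ0 : ∀ x y, (¬ ∃ u, P u x y) → φ x y = 0 := fun x y h => by simp only [φ, dif_neg h]
  -- (b) symmetry
  have hPswap : ∀ u x y, P u x y → P u y x := by
    rintro u x y (h | h)
    · exact Or.inr h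
    · exact Or.inl h
  have hsymm : ∀ x y, φ x y = φ y x := by
    intro x y
    by_cases h : ∃ u, P u x y
    · obtain ⟨u, hu⟩ := h
      rw [hφP u x y hu, hφP u y x (hPswap u x y hu)]
    · have h' : ¬ ∃ u, P u y x := fun ⟨u, hu⟩ => h ⟨u, hPswap u y x hu⟩
      rw [hφ0 x y h, hφ0 y x h']
  -- (c) support on edges
  have hadjrn : (latticeGraph σ ϖ ((StdForm.antidiagonal 3).over K)).Adj r n := latticeGraph_adj_root_N₁ hd
  have hPadj : ∀ u x y, P u x y → (latticeGraph σ ϖ ((StdForm.antidiagonal 3).over K)).Adj x y := by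
    rintro u x y (⟨h1, h2⟩ | ⟨h1, h2⟩)
    · rw [← h1, ← h2]; exact ((latticeGraphIso σ ϖ ((StdForm.antidiagonal 3).over K) u).map_rel_iff').2 hadjrn
    · rw [← h1, ← h2]; exact ((latticeGraphIso σ ϖ ((StdForm.antidiagonal 3).over K) u).map_rel_iff').2 hadjrn.symm
  have hadj : ∀ x y, φ x y ≠ 0 → (latticeGraph σ ϖ ((StdForm.antidiagonal 3).over K)).Adj x y := by
    intro x y hxy
    by_cases h : ∃ u, P u x y
    · obtain ⟨u, hu⟩ := h; exact hPadj u x y hu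
    · exact absurd (hφ0 x y h) hxy
  -- (d) finite support: both ends of a support edge lie in the finite set of translates of `r`, `n` by the compact support of the coefficient
  obtain ⟨C, hC, hsupp⟩ : ∃ C : Set ↥(unitaryGroupOfForm σ ((StdForm.antidiagonal 3).over K)), IsCompact C ∧ Function.support (ρ.matrixCoeff ℓ v) ⊆ C := ⟨_, hcs, subset_tsupport _⟩
  have hFr : Set.Finite ((fun u : ↥(unitaryGroupOfForm σ ((StdForm.antidiagonal 3).over K)) => mapGL (u : GL (Fin 3) K) (stdLattice K 3)) '' C) :=
    finite_image_mapGL_of_isCompact K₀ (isOpen_glInt_subgroupOf σ _) (stdLattice K 3)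
      (fun u hu => congrArg Subtype.val ((hK₀r u).1 hu)) hC
  have hFn : Set.Finite ((fun u : ↥(unitaryGroupOfForm σ ((StdForm.antidiagonal 3).over K)) => mapGL (u : GL (Fin 3) K) (latt (Matrix.diagonal ![(1 : K), 1, ϖ]))) '' C) :=
    finite_image_mapGL_of_isCompact K₁ (isOpen_conj_glInt_subgroupOf σ _ g₁) (latt (Matrix.diagonal ![(1 : K), 1, ϖ]))
      (fun u hu => congrArg Subtype.val ((hK₁n u).1 hu)) hC
  have hF : Set.Finite {x : {M : Submodule 𝒪[K] (Fin 3 → K) // IsVertex σ ϖ ((StdForm.antidiagonal 3).over K) M} |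
      x.1 ∈ ((fun u : ↥(unitaryGroupOfForm σ ((StdForm.antidiagonal 3).over K)) => mapGL (u : GL (Fin 3) K) (stdLattice K 3)) '' C) ∪
        ((fun u : ↥(unitaryGroupOfForm σ ((StdForm.antidiagonal 3).over K)) => mapGL (u : GL (Fin 3) K) (latt (Matrix.diagonal ![(1 : K), 1, ϖ]))) '' C)} :=
    (hFr.union hFn).preimage Subtype.val_injective.injOn
  have hmemF : ∀ u : ↥(unitaryGroupOfForm σ ((StdForm.antidiagonal 3).over K)), ℓ (ρ u v) ≠ 0 → ∀ z, (z = latticeGraphPerm σ ϖ ((StdForm.antidiagonal 3).over K) u r ∨ z = latticeGraphPerm σ ϖ ((StdForm.antidiagonal 3).over K) u n) →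
      z.1 ∈ ((fun u : ↥(unitaryGroupOfForm σ ((StdForm.antidiagonal 3).over K)) => mapGL (u : GL (Fin 3) K) (stdLattice K 3)) '' C) ∪
        ((fun u : ↥(unitaryGroupOfForm σ ((StdForm.antidiagonal 3).over K)) => mapGL (u : GL (Fin 3) K) (latt (Matrix.diagonal ![(1 : K), 1, ϖ]))) '' C) := by
    intro u hu z hz
    have huC : u ∈ C := hsupp (by rw [Function.mem_support, Representation.matrixCoeff_apply]; exact hu)
    rcases hz with rfl | rfl
    · exact Or.inl ⟨u, huC, rfl⟩
    · exact Or.inr ⟨u, huC, rfl⟩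
  have hfin : (Function.support (Function.uncurry φ)).Finite := by
    refine (hF.prod hF).subset ?_
    rintro ⟨x, y⟩ hxy
    rw [Function.mem_support, Function.uncurry_apply_pair] at hxy
    by_cases h : ∃ u, P u x y
    · have hne : ℓ (ρ h.choose v) ≠ 0 := by simpa only [φ, dif_pos h] using hxy
      rcases h.choose_spec with ⟨h1, h2⟩ | ⟨h1, h2⟩
      · exact ⟨hmemF _ hne x (Or.inl h1.symm), hmemF _ hne y (Or.inr h2.symm)⟩
      · exact ⟨hmemF _ hne x (Or.inr h2.symm), hmemF _ hne y (Or.inl h1.symm)⟩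
    · exact absurd (hφ0 x y h) hxy
  -- (e) vertex sums: around `g·r` the support edges are `{g·r, g k·n}`, `k ∈ K₀ / I`, and `Σ_{K₀/I} ρ(k) v ∈ V^{K₀} = 0`; likewise around `g·n`
  have hsum_r : ∀ g : ↥(unitaryGroupOfForm σ ((StdForm.antidiagonal 3).over K)), ∑ᶠ w, φ (latticeGraphPerm σ ϖ ((StdForm.antidiagonal 3).over K) g r) w = 0 := by
    intro g
    -- finiteness of `K₀ / I`
    haveI : CompactSpace ↥K₀ := isCompact_iff_compactSpace.mp (isCompact_glInt_subgroupOf σ ((StdForm.antidiagonal 3).over K) hσ)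
    have hNo : IsOpen (((K₀ ⊓ K₁).subgroupOf K₀ : Subgroup ↥K₀) : Set ↥K₀) := hIo.preimage continuous_subtype_val
    haveI : DiscreteTopology (↥K₀ ⧸ (K₀ ⊓ K₁).subgroupOf K₀) := QuotientGroup.discreteTopology hNo
    haveI : Finite (↥K₀ ⧸ (K₀ ⊓ K₁).subgroupOf K₀) := finite_of_compact_of_discrete
    letI : Fintype (↥K₀ ⧸ (K₀ ⊓ K₁).subgroupOf K₀) := Fintype.ofFinite _
    -- the parametrisation of the star of `g·r`
    let e : ↥K₀ ⧸ (K₀ ⊓ K₁).subgroupOf K₀ → {M : Submodule 𝒪[K] (Fin 3 → K) // IsVertex σ ϖ ((StdForm.antidiagonal 3).over K) M} :=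
      fun c => latticeGraphPerm σ ϖ ((StdForm.antidiagonal 3).over K) (g * ((c.out : ↥K₀) : ↥(unitaryGroupOfForm σ ((StdForm.antidiagonal 3).over K)))) n
    have heP : ∀ c, P (g * ((c.out : ↥K₀) : ↥(unitaryGroupOfForm σ ((StdForm.antidiagonal 3).over K)))) (latticeGraphPerm σ ϖ ((StdForm.antidiagonal 3).over K) g r) (e c) := by
      intro c
      refine Or.inl ⟨?_, rfl⟩
      rw [latticeGraphPerm_mul_apply, (hK₀r _).1 (c.out).2]
    have hsupp_e : Function.support (fun w => φ (latticeGraphPerm σ ϖ ((StdForm.antidiagonal 3).over K) g r) w) ⊆ ↑(Finset.univ.image e) := by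
      intro w hw
      rw [Function.mem_support] at hw
      have hadj' := hadj _ _ hw
      -- pull back to the star of `r`
      have hadj'' : (latticeGraph σ ϖ ((StdForm.antidiagonal 3).over K)).Adj r (latticeGraphPerm σ ϖ ((StdForm.antidiagonal 3).over K) g⁻¹ w) := by
        have h := ((latticeGraphIso σ ϖ ((StdForm.antidiagonal 3).over K) g⁻¹).map_rel_iff').2 hadj'
        change (latticeGraph σ ϖ ((StdForm.antidiagonal 3).over K)).Adj (latticeGraphPerm σ ϖ ((StdForm.antidiagonal 3).over K) g⁻¹ (latticeGraphPerm σ ϖ ((StdForm.antidiagonal 3).over K) g r))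
          (latticeGraphPerm σ ϖ ((StdForm.antidiagonal 3).over K) g⁻¹ w) at h
        rwa [← latticeGraphPerm_mul_apply, inv_mul_cancel, latticeGraphPerm_one_apply] at h
      obtain ⟨k, hk, hkw⟩ := exists_mem_glInt_subgroupOf_latticeGraphPerm_N₁_eq_of_adj_root hd g₁ hg₁ hadj''
      rw [Finset.coe_image, Finset.coe_univ, Set.image_univ]
      refine ⟨QuotientGroup.mk (⟨k, hk⟩ : ↥K₀), ?_⟩
      -- `e (mk k) = g k · n`
      obtain ⟨j, hj⟩ := QuotientGroup.mk_out_eq_mul ((K₀ ⊓ K₁).subgroupOf K₀) (⟨k, hk⟩ : ↥K₀)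
      have hjn : latticeGraphPerm σ ϖ ((StdForm.antidiagonal 3).over K) ((j : ↥K₀) : ↥(unitaryGroupOfForm σ ((StdForm.antidiagonal 3).over K))) n = n :=
        (hK₁n _).1 (Subgroup.mem_inf.1 (Subgroup.mem_subgroupOf.1 j.2)).2
      change latticeGraphPerm σ ϖ ((StdForm.antidiagonal 3).over K) (g * (((QuotientGroup.mk (⟨k, hk⟩ : ↥K₀) : ↥K₀ ⧸ (K₀ ⊓ K₁).subgroupOf K₀).out : ↥K₀) : ↥(unitaryGroupOfForm σ ((StdForm.antidiagonal 3).over K)))) n = w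
      rw [hj, Subgroup.coe_mul, latticeGraphPerm_mul_apply, latticeGraphPerm_mul_apply, hjn]
      change latticeGraphPerm σ ϖ ((StdForm.antidiagonal 3).over K) g (latticeGraphPerm σ ϖ ((StdForm.antidiagonal 3).over K) k n) = w
      rw [hkw, ← latticeGraphPerm_mul_apply, mul_inv_cancel, latticeGraphPerm_one_apply]
    have hinj : Function.Injective e := by
      intro c c' hcc'
      have h1 : latticeGraphPerm σ ϖ ((StdForm.antidiagonal 3).over K) (((c.out : ↥K₀) : ↥(unitaryGroupOfForm σ ((StdForm.antidiagonal 3).over K)))⁻¹ * ((c'.out : ↥K₀) : ↥(unitaryGroupOfForm σ ((StdForm.antidiagonal 3).over K)))) n = n := by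
        have h := congrArg (latticeGraphPerm σ ϖ ((StdForm.antidiagonal 3).over K) (g * ((c.out : ↥K₀) : ↥(unitaryGroupOfForm σ ((StdForm.antidiagonal 3).over K))))⁻¹) hcc'
        simp only [e] at h
        rw [← latticeGraphPerm_mul_apply, ← latticeGraphPerm_mul_apply, inv_mul_cancel, latticeGraphPerm_one_apply, _root_.mul_inv_rev, mul_assoc,
          inv_mul_cancel_left] at h
        exact h.symm
      have hmem : (c.out)⁻¹ * c'.out ∈ (K₀ ⊓ K₁).subgroupOf K₀ := by
        rw [Subgroup.mem_subgroupOf, Subgroup.coe_mul, Subgroup.coe_inv]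
        exact Subgroup.mem_inf.2 ⟨Subgroup.mul_mem _ (Subgroup.inv_mem _ (c.out).2) (c'.out).2, (hK₁n _).2 h1⟩
      rw [← QuotientGroup.out_eq' c, ← QuotientGroup.out_eq' c', QuotientGroup.eq]
      exact hmem
    rw [finsum_eq_sum_of_support_subset _ hsupp_e, Finset.sum_image fun c _ c' _ h => hinj h]
    have hterm : ∀ c, φ (latticeGraphPerm σ ϖ ((StdForm.antidiagonal 3).over K) g r) (e c) = ℓ (ρ g (ρ ((c.out : ↥K₀) : ↥(unitaryGroupOfForm σ ((StdForm.antidiagonal 3).over K))) v)) := by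
      intro c
      rw [hφP _ _ _ (heP c), map_mul, Module.End.mul_apply]
    simp only [hterm]
    rw [← map_sum, ← map_sum]
    have hfix : (∑ c : ↥K₀ ⧸ (K₀ ⊓ K₁).subgroupOf K₀, ρ ((c.out : ↥K₀) : ↥(unitaryGroupOfForm σ ((StdForm.antidiagonal 3).over K))) v) ∈ ρ.fixedPoints K₀ :=
      ρ.sum_quotient_out_apply_mem_fixedPoints_of_subgroup ((K₀ ⊓ K₁).subgroupOf K₀) fun j hj => hvI _ (Subgroup.mem_subgroupOf.1 hj)
    rw [h₀, Submodule.mem_bot] at hfix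
    rw [hfix, map_zero, map_zero]
  have hsum_n : ∀ g : ↥(unitaryGroupOfForm σ ((StdForm.antidiagonal 3).over K)), ∑ᶠ w, φ (latticeGraphPerm σ ϖ ((StdForm.antidiagonal 3).over K) g n) w = 0 := by
    intro g
    haveI : CompactSpace ↥K₁ := isCompact_iff_compactSpace.mp (isCompact_conj_glInt_subgroupOf σ ((StdForm.antidiagonal 3).over K) g₁ hσ)
    have hNo : IsOpen (((K₀ ⊓ K₁).subgroupOf K₁ : Subgroup ↥K₁) : Set ↥K₁) := hIo.preimage continuous_subtype_val
    haveI : DiscreteTopology (↥K₁ ⧸ (K₀ ⊓ K₁).subgroupOf K₁) := QuotientGroup.discreteTopology hNo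
    haveI : Finite (↥K₁ ⧸ (K₀ ⊓ K₁).subgroupOf K₁) := finite_of_compact_of_discrete
    letI : Fintype (↥K₁ ⧸ (K₀ ⊓ K₁).subgroupOf K₁) := Fintype.ofFinite _
    let e : ↥K₁ ⧸ (K₀ ⊓ K₁).subgroupOf K₁ → {M : Submodule 𝒪[K] (Fin 3 → K) // IsVertex σ ϖ ((StdForm.antidiagonal 3).over K) M} :=
      fun c => latticeGraphPerm σ ϖ ((StdForm.antidiagonal 3).over K) (g * ((c.out : ↥K₁) : ↥(unitaryGroupOfForm σ ((StdForm.antidiagonal 3).over K)))) r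
    have heP : ∀ c, P (g * ((c.out : ↥K₁) : ↥(unitaryGroupOfForm σ ((StdForm.antidiagonal 3).over K)))) (latticeGraphPerm σ ϖ ((StdForm.antidiagonal 3).over K) g n) (e c) := by
      intro c
      refine Or.inr ⟨rfl, ?_⟩
      rw [latticeGraphPerm_mul_apply, (hK₁n _).1 (c.out).2]
    have hsupp_e : Function.support (fun w => φ (latticeGraphPerm σ ϖ ((StdForm.antidiagonal 3).over K) g n) w) ⊆ ↑(Finset.univ.image e) := by
      intro w hw
      rw [Function.mem_support] at hw
      have hadj' := hadj _ _ hw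
      have hadj'' : (latticeGraph σ ϖ ((StdForm.antidiagonal 3).over K)).Adj n (latticeGraphPerm σ ϖ ((StdForm.antidiagonal 3).over K) g⁻¹ w) := by
        have h := ((latticeGraphIso σ ϖ ((StdForm.antidiagonal 3).over K) g⁻¹).map_rel_iff').2 hadj'
        change (latticeGraph σ ϖ ((StdForm.antidiagonal 3).over K)).Adj (latticeGraphPerm σ ϖ ((StdForm.antidiagonal 3).over K) g⁻¹ (latticeGraphPerm σ ϖ ((StdForm.antidiagonal 3).over K) g n))
          (latticeGraphPerm σ ϖ ((StdForm.antidiagonal 3).over K) g⁻¹ w) at h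
        rwa [← latticeGraphPerm_mul_apply, inv_mul_cancel, latticeGraphPerm_one_apply] at h
      obtain ⟨k, hk, hkw⟩ := exists_mem_conj_glInt_subgroupOf_latticeGraphPerm_root_eq_of_adj_N₁ hd g₁ hg₁ hadj''
      rw [Finset.coe_image, Finset.coe_univ, Set.image_univ]
      refine ⟨QuotientGroup.mk (⟨k, hk⟩ : ↥K₁), ?_⟩
      obtain ⟨j, hj⟩ := QuotientGroup.mk_out_eq_mul ((K₀ ⊓ K₁).subgroupOf K₁) (⟨k, hk⟩ : ↥K₁)
      have hjr : latticeGraphPerm σ ϖ ((StdForm.antidiagonal 3).over K) ((j : ↥K₁) : ↥(unitaryGroupOfForm σ ((StdForm.antidiagonal 3).over K))) r = r :=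
        (hK₀r _).1 (Subgroup.mem_inf.1 (Subgroup.mem_subgroupOf.1 j.2)).1
      change latticeGraphPerm σ ϖ ((StdForm.antidiagonal 3).over K) (g * (((QuotientGroup.mk (⟨k, hk⟩ : ↥K₁) : ↥K₁ ⧸ (K₀ ⊓ K₁).subgroupOf K₁).out : ↥K₁) : ↥(unitaryGroupOfForm σ ((StdForm.antidiagonal 3).over K)))) r = w
      rw [hj, Subgroup.coe_mul, latticeGraphPerm_mul_apply, latticeGraphPerm_mul_apply, hjr]
      change latticeGraphPerm σ ϖ ((StdForm.antidiagonal 3).over K) g (latticeGraphPerm σ ϖ ((StdForm.antidiagonal 3).over K) k r) = w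
      rw [hkw, ← latticeGraphPerm_mul_apply, mul_inv_cancel, latticeGraphPerm_one_apply]
    have hinj : Function.Injective e := by
      intro c c' hcc'
      have h1 : latticeGraphPerm σ ϖ ((StdForm.antidiagonal 3).over K) (((c.out : ↥K₁) : ↥(unitaryGroupOfForm σ ((StdForm.antidiagonal 3).over K)))⁻¹ * ((c'.out : ↥K₁) : ↥(unitaryGroupOfForm σ ((StdForm.antidiagonal 3).over K)))) r = r := by
        have h := congrArg (latticeGraphPerm σ ϖ ((StdForm.antidiagonal 3).over K) (g * ((c.out : ↥K₁) : ↥(unitaryGroupOfForm σ ((StdForm.antidiagonal 3).over K))))⁻¹) hcc'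
        simp only [e] at h
        rw [← latticeGraphPerm_mul_apply, ← latticeGraphPerm_mul_apply, inv_mul_cancel, latticeGraphPerm_one_apply, _root_.mul_inv_rev, mul_assoc,
          inv_mul_cancel_left] at h
        exact h.symm
      have hmem : (c.out)⁻¹ * c'.out ∈ (K₀ ⊓ K₁).subgroupOf K₁ := by
        rw [Subgroup.mem_subgroupOf, Subgroup.coe_mul, Subgroup.coe_inv]
        exact Subgroup.mem_inf.2 ⟨(hK₀r _).2 h1, Subgroup.mul_mem _ (Subgroup.inv_mem _ (c.out).2) (c'.out).2⟩
      rw [← QuotientGroup.out_eq' c, ← QuotientGroup.out_eq' c', QuotientGroup.eq]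
      exact hmem
    rw [finsum_eq_sum_of_support_subset _ hsupp_e, Finset.sum_image fun c _ c' _ h => hinj h]
    have hterm : ∀ c, φ (latticeGraphPerm σ ϖ ((StdForm.antidiagonal 3).over K) g n) (e c) = ℓ (ρ g (ρ ((c.out : ↥K₁) : ↥(unitaryGroupOfForm σ ((StdForm.antidiagonal 3).over K))) v)) := by
      intro c
      rw [hφP _ _ _ (heP c), map_mul, Module.End.mul_apply]
    simp only [hterm]
    rw [← map_sum, ← map_sum]
    have hfix : (∑ c : ↥K₁ ⧸ (K₀ ⊓ K₁).subgroupOf K₁, ρ ((c.out : ↥K₁) : ↥(unitaryGroupOfForm σ ((StdForm.antidiagonal 3).over K))) v) ∈ ρ.fixedPoints K₁ :=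
      ρ.sum_quotient_out_apply_mem_fixedPoints_of_subgroup ((K₀ ⊓ K₁).subgroupOf K₁) fun j hj => hvI _ (Subgroup.mem_subgroupOf.1 hj)
    rw [h₁, Submodule.mem_bot] at hfix
    rw [hfix, map_zero, map_zero]
  have hsum : ∀ x, ∑ᶠ w, φ x w = 0 := by
    intro x
    by_cases hx : IsSelfDualLattice σ ϖ ((StdForm.antidiagonal 3).over K) x.1
    · obtain ⟨g, hg⟩ := exists_latticeGraphIso_root_eq hd x hx
      rw [← hg]
      exact hsum_r g
    · obtain ⟨g, hg⟩ := exists_latticeGraphIso_N₁_eq hd x (isVertexLattice_two_of_not_isSelfDualLattice hd x hx)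
      rw [← hg]
      exact hsum_n g
  -- (f) conclusion: `φ = 0`, so `ℓ v = φ(r, n) = 0`
  have key := TreeHarmonic.eq_zero_of_forall_finsum_adj_eq_zero (isTree_latticeGraph_three_of_unramified hd) φ hsymm hadj hfin hsum r n
  have hP1 : P 1 r n := Or.inl ⟨latticeGraphPerm_one_apply r, latticeGraphPerm_one_apply n⟩
  rw [hφP 1 r n hP1, map_one, Module.End.one_apply] at key
  exact hℓv key

end Literature.NumberTheory.Automorphic.UnitaryLatticeTree

end
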